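import Summits.ResolutionOfSingularities.ResolutionOfSingularities.Theorems.WeightedInvariantIota3TauDescentDoor
import Summits.ResolutionOfSingularities.ResolutionOfSingularities.Theorems.WeightedInvariantHypersurfaceLocalGameEFTDimTwoSteepening
import HarnessLib

/-!
# (desc-τ), CASE B: (ADAPT) ⟸ an rsp-adapted ADMISSIBLE pair; equal-dimension descent holds outright when the tie's weights are `(1, 1)`
# (door `HypersurfaceCentreConstruction`, stmt-ResolutionOfSingularities-19897; gap (1) (desc-τ), case B after …Iota3TauDescentCaseB / …Door)

Topic: `Summits/ResolutionOfSingularities/ResolutionOfSingularities/Theorems`. Helper for the door item `HypersurfaceCentreConstruction`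
(stmt-ResolutionOfSingularities-19897, route `WeightedInvariant`), line `local-engine`, def-free.  …Iota3TauDescentDoor reduced (desc-τ) in the door setting
to (ADAPT): an rsp-adapted LEX-MAXIMAL datum at `(T, g)`.  THIS FILE removes lex-maximality from that hypothesis — only ADMISSIBILITY of an rsp-adapted pair for
the weights of the tie upstairs is needed — and settles the weights-`(1,1)` case, where admissibility is automatic:

* `Iota3.isLexMaxWeightedCentreGerm_of_admissible` — next to a lex-maximal datum `(x; w; ℓ)`, EVERY generating pair admissible for `(w, ℓ)` is lex-maximal
  (the maximality and uniqueness clauses of Abramovich–Quek–Schober do not see the pair).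
* `Iota3.isLexMaxWeightedCentreGerm_of_map` — DESCENT of lex-maximality for a GIVEN admissible generating pair along a faithfully flat algebra of local rings
  with `𝔪_S S' = 𝔪_{S'}` (competitors and filtrations extend, filtrations contract by faithful flatness).
* **`Iota3.isTiePosition_of_adapted_admissible`** — case (B) of (desc-τ) from an rsp `(x, y, z)` of `T` with `(x, y) = P₀(T, g)` and
  `g/1 ∈ 𝒥_{rν}((y/1, x/1); (r, q))` in `T_{P₀}`, `(q, r; ν)` the data of a tie presentation of `(T', φ g)`.
* **`Iota3.isTiePosition_of_adapted_rsp_of_weights_one`** — if the tie upstairs has weights `q = r` (`= 1`), ANY rsp `(x, y, z)` of `T` with `(x, y) = P₀`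
  descends it (`𝒥ₙ((y,x);(1,1)) = P₀ⁿ` and `g ∈ P₀^ν` by equimultiplicity along `V(P₀)`).

[OURS · L1 W4.3 · (desc-τ) case B, (ADAPT) ⟸ (ADAPT₀)]  Replaces the role of NO printed item; NOT a statement of the manuscript under review
[claim: Hironaka2017, status: under-review]; candidates stay candidates; AI work, weaker than expert review.  No definition; no axiom.

## References

* D. Abramovich, M. H. Quek, B. Schober, arXiv:2507.01232 (2025), Thm 3.5 («well-defined, unique»; stability under separable base change). [AbramovichQuekSchober2025]
* H. Matsumura, *Commutative Ring Theory* (1986), Thm. 7.5 (faithful flatness). [Matsumura1987]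
-/

noncomputable section

set_option linter.dupNamespace false -- mandated namespace `Summit.<Summit>.<Problem>` of this single-conjunct summit

open IsLocalRing Literature.AlgebraicGeometry.Resolution
open Summit.ResolutionOfSingularities.ResolutionOfSingularities.Theorems
open Summit.ResolutionOfSingularities.ResolutionOfSingularities.Theorems.ContactCylinder

namespace Summit.ResolutionOfSingularities.ResolutionOfSingularities.Cruxes.HypersurfaceCentreConstruction.LocalEngine

namespace Iota3

/-! ## §1 Admissible generating pairs next to a lex-maximal datum are lex-maximal -/

/-- **Every generating pair admissible for the lex-maximal `(w, ℓ)` is itself lex-maximal.** [cite: AbramovichQuekSchober2025, Thm 3.5] -/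
theorem isLexMaxWeightedCentreGerm_of_admissible {O : Type} [CommRing O] [IsLocalRing O] {I : Ideal O} {x y : Fin 2 → O}
    {w : Fin 2 → ℕ} {ℓ : ℕ} (h : IsLexMaxWeightedCentreGerm O I x w ℓ) (hy : Ideal.span (Set.range y) = maximalIdeal O)
    (hI : I ≤ weightedMonomialIdeal y w ℓ) : IsLexMaxWeightedCentreGerm O I y w ℓ := by
  obtain ⟨hspan, hpos, hcop, hle, hℓ, hdvd, hadm, hmax, huniq⟩ := h
  refine ⟨hy, hpos, hcop, hle, hℓ, hdvd, hI, hmax, fun y' hy' hI' n => ?_⟩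
  rw [huniq y' hy' hI' n, huniq y hy hI n]

/-! ## §2 Descent of lex-maximality for a given admissible pair -/

/-- **DESCENT OF LEX-MAXIMALITY FOR A GIVEN PAIR** along a faithfully flat algebra of local rings `S → S'` with `𝔪_S S' = 𝔪_{S'}`: if `x` generates `𝔪_S`,
`(f) ≤ 𝒥_ℓ(x; w)`, and `(φ ∘ x; w; ℓ)` is lex-maximal for `(φ f)`, then `(x; w; ℓ)` is lex-maximal for `(f)`. [cite: Matsumura1987, Thm. 7.5] -/
theorem isLexMaxWeightedCentreGerm_of_map {S S' : Type} [CommRing S] [CommRing S'] [IsLocalRing S] [IsLocalRing S'] [Algebra S S']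
    [Module.FaithfullyFlat S S'] (h𝔪 : (maximalIdeal S).map (algebraMap S S') = maximalIdeal S')
    {f : S} {x : Fin 2 → S} {w : Fin 2 → ℕ} {ℓ : ℕ} (hspan : Ideal.span (Set.range x) = maximalIdeal S)
    (hadm : Ideal.span {f} ≤ weightedMonomialIdeal x w ℓ)
    (h' : IsLexMaxWeightedCentreGerm S' (Ideal.span {algebraMap S S' f}) (fun i => algebraMap S S' (x i)) w ℓ) :
    IsLexMaxWeightedCentreGerm S (Ideal.span {f}) x w ℓ := by
  obtain ⟨-, hpos, hcop, hle, hℓ, hdvd, -, hmax, huniq⟩ := h'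
  -- pushing generating families and admissibility forward
  have hspan_up : ∀ y : Fin 2 → S, Ideal.span (Set.range y) = maximalIdeal S →
      Ideal.span (Set.range fun i => algebraMap S S' (y i)) = maximalIdeal S' := fun y hy => by
    rw [Set.range_comp', ← Ideal.map_span, hy, h𝔪]
  have hadm_up : ∀ (y : Fin 2 → S) (w' : Fin 2 → ℕ) (ℓ' : ℕ), Ideal.span {f} ≤ weightedMonomialIdeal y w' ℓ' →
      Ideal.span {algebraMap S S' f} ≤ weightedMonomialIdeal (fun i => algebraMap S S' (y i)) w' ℓ' := fun y w' ℓ' h => by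
    rw [Ideal.span_singleton_le_iff_mem] at h ⊢
    rw [← weightedMonomialIdeal_map]
    exact Ideal.mem_map_of_mem _ h
  refine ⟨hspan, hpos, hcop, hle, hℓ, hdvd, hadm, fun y' w' ℓ' hy' hw' hw'le hℓ' hI' =>
    hmax _ w' ℓ' (hspan_up y' hy') hw' hw'le hℓ' (hadm_up y' w' ℓ' hI'), fun y' hy' hI' n => ?_⟩
  have hup := huniq _ (hspan_up y' hy') (hadm_up y' w ℓ hI') n
  rw [← weightedMonomialIdeal_map, ← weightedMonomialIdeal_map] at hup
  have h1 := congrArg (Ideal.comap (algebraMap S S')) hup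
  simp only [Ideal.comap_map_eq_self_of_faithfullyFlat] at h1
  exact h1

/-! ## §3 Case B from an rsp-adapted admissible pair -/

section CaseB

variable (T T' : Type) [CommRing T] [CommRing T'] [IsRegularLocalRing T] [IsRegularLocalRing T'] [Algebra T T']
  [IsLocalHom (algebraMap T T')] [Algebra.FormallySmooth T T'] [Algebra.EssFiniteType T T']

/-- **CASE B OF (desc-τ) FROM AN rsp-ADAPTED ADMISSIBLE PAIR.**  `φ : T → T'` local, formally smooth, essentially of finite type, regular local rings,
`dim T = 3`; `(x', y', z'; q, r; λ')` a tie presentation of `(T', φ g)` with order `ν`; `(x, y, z)` a regular system of parameters of `T` with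
`(x, y) = P₀(T, g)` and `g/1 ∈ 𝒥_{rν}((y/1, x/1); (r, q))` in `T_{P₀}`.  Then `(T, g)` is a tie position. [cite: AbramovichQuekSchober2025, Thm 3.5] -/
theorem isTiePosition_of_adapted_admissible (hdimT : ringKrullDim T = (3 : ℕ)) {g : T} (ht' : IsTiePosition T' (algebraMap T T' g))
    {x' y' z' : T'} {q r : ℕ} {lam' : T'} (h' : IsTiePresentation T' (algebraMap T T' g) x' y' z' q r lam')
    {ν : ℕ} (hfν : algebraMap T T' g ∈ maximalIdeal T' ^ ν) (hfν1 : algebraMap T T' g ∉ maximalIdeal T' ^ (ν + 1))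
    {x y z : T} [hP : (Ideal.span ({x, y} : Set T)).IsPrime] (hxyz : Ideal.span {x, y, z} = maximalIdeal T)
    (hP₀ : topStratumPrime iotaOrdEps T g = Ideal.span {x, y})
    (hadm : algebraMap T (Localization.AtPrime (Ideal.span ({x, y} : Set T))) g ∈
      weightedMonomialIdeal ![algebraMap T (Localization.AtPrime (Ideal.span ({x, y} : Set T))) y,
        algebraMap T (Localization.AtPrime (Ideal.span ({x, y} : Set T))) x] ![r, q] (r * ν)) :
    IsTiePosition T g := by
  classical
  -- dimensions and `𝔪_T T' = 𝔪'`
  obtain ⟨hdimT'n, -⟩ := ringKrullDim_eq_of_isTiePosition_map T T' ht'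
  have hdim3 : ringKrullDim T = 3 := by rw [hdimT]; rfl
  have hdim3' : ringKrullDim T' = 3 := by rw [hdimT'n]; rfl
  have h𝔪 : (maximalIdeal T).map (algebraMap T T') = maximalIdeal T' :=
    EssSmoothLE2.map_maximalIdeal_eq_of_ringKrullDim_eq T T' (by rw [hdimT, hdimT'n])
  haveI : Module.Flat T T' := IotaOrderEssSmooth.flat_of_formallySmooth_of_essFiniteType T T'
  obtain ⟨-, -, ν', hP'inst, hν'1, hν'2, hlex0, -⟩ := id h'
  haveI := hP'inst
  obtain rfl : ν = ν' := by
    by_contra hne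
    rcases Nat.lt_or_gt_of_ne hne with hlt | hgt
    · exact hfν1 (Ideal.pow_le_pow_right (by omega) hν'1)
    · exact hν'2 (Ideal.pow_le_pow_right (by omega) hfν)
  have hlex' : IsLexMaxWeightedCentreGerm (Localization.AtPrime (Ideal.span ({x', y'} : Set T')))
      (Ideal.span {algebraMap T' _ (algebraMap T T' g)}) ![algebraMap T' _ y', algebraMap T' _ x'] ![r, q] (r * ν) := hlex0
  -- `g`: order, `ε`, the stratum and its extension
  obtain ⟨hgν, hgν1⟩ := mem_pow_and_not_mem_of_map T T' hfν hfν1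
  have hg0 : g ≠ 0 := fun h0 => ht'.ne_zero (by rw [h0, map_zero])
  have hg𝔪 : g ∈ maximalIdeal T := by
    refine (IsLocalRing.mem_maximalIdeal g).mpr (mem_nonunits_iff.mpr fun hu => ?_)
    exact (IsLocalRing.mem_maximalIdeal _).mp ht'.mem_maximalIdeal (hu.map (algebraMap T T'))
  have hnm : ¬ IsMonomialType g := not_isMonomialType_of_isTiePosition_map T T' ht'
  have hν : iotaOrd T g = ν := (iotaOrd_eq_natCast_iff T g ν).mpr ⟨hgν, hgν1⟩
  obtain ⟨_, -, hε', -, -⟩ := id ht'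
  have hε : iotaEps T g = 0 := by rw [← iotaEps_essSmooth_eq T T' g]; exact hε'
  obtain ⟨hP₀p, hreg, -, hE, -, -⟩ := topStratumPrime_iotaOrdEps_spec (le_of_eq hdim3) hg0 hg𝔪 hν
  obtain ⟨hP₀'p, -, -, hP₀map⟩ := topStratumPrime_iotaOrdEps_map_eq T T' g hreg hE
  have hPmap : (topStratumPrime iotaOrdEps T g).map (algebraMap T T') =
      Ideal.span {algebraMap T T' x, algebraMap T T' y} := by rw [hP₀, map_span_pair]
  haveI hPxy' : (Ideal.span ({algebraMap T T' x, algebraMap T T' y} : Set T')).IsPrime := hPmap ▸ hP₀'p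
  have hP₀'' : topStratumPrime iotaOrdEps T' (algebraMap T T' g) = Ideal.span {algebraMap T T' x, algebraMap T T' y} :=
    hP₀map.trans hPmap
  -- `dim T_{(x,y)} = 2`
  have hsf : (maximalIdeal T).spanFinrank = 3 := spanFinrank_eq_three_of_ringKrullDim hdim3
  have hdimP : ringKrullDim (Localization.AtPrime (Ideal.span ({x, y} : Set T))) = (2 : ℕ) := by
    refine le_antisymm (ringKrullDim_atPrime_span_pair_le_two x y) ?_
    have hmem : (⟨Ideal.span {x, y}, hP⟩ : PrimeSpectrum T) ∈ topStratum iotaOrd T g := by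
      rw [← topStratum_iotaOrdEps_eq_topStratum_iotaOrd_of_iotaEps_eq_zero hg𝔪 hε, hE, Set.mem_setOf_eq, hP₀]
    have hht := two_le_height_of_mem_topStratum_iotaOrd hg0 hg𝔪 hnm hmem
    dsimp only at hht
    rw [IsLocalization.AtPrime.ringKrullDim_eq_height (Ideal.span ({x, y} : Set T)) (Localization.AtPrime (Ideal.span ({x, y} : Set T)))]
    have h2 : ((2 : ℕ) : WithBot ℕ∞) = (((2 : ℕ) : ℕ∞) : WithBot ℕ∞) := rfl
    rw [h2]
    exact WithBot.coe_le_coe.mpr (by exact_mod_cast hht)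
  -- the pushed pair is cotangent independent and lies in the plane; AQS uniqueness makes it lex-maximal upstairs
  have hsf' : (maximalIdeal T').spanFinrank = 3 := spanFinrank_eq_three_of_ringKrullDim hdim3'
  have hxyz'' : Ideal.span {algebraMap T T' x, algebraMap T T' y, algebraMap T T' z} = maximalIdeal T' := by
    rw [← map_span_triple, hxyz, h𝔪]
  have hyxz'' : Ideal.span (Set.range ![algebraMap T T' y, algebraMap T T' x, algebraMap T T' z]) = maximalIdeal T' := by
    rw [← hxyz'', Matrix.range_cons, Matrix.range_cons, Matrix.range_cons, Matrix.range_empty, Set.union_empty,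
      Set.singleton_union, Set.singleton_union, Set.insert_comm]
  have hu : ∀ i, (![algebraMap T T' y, algebraMap T T' x] : Fin 2 → T') i ∈ maximalIdeal T' :=
    LocalGameEFTCylinder.mem_maximalIdeal_pair hyxz''
  have hli := LocalGameEFTCylinder.linearIndependent_toCotangent_pair hyxz'' hsf'
  have huP : ∀ i, (![algebraMap T T' y, algebraMap T T' x] : Fin 2 → T') i ∈
      Ideal.span ({algebraMap T T' x, algebraMap T T' y} : Set T') := by
    intro i; fin_cases i
    · exact Ideal.subset_span (Set.mem_insert_of_mem _ (Set.mem_singleton _))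
    · exact Ideal.subset_span (Set.mem_insert _ _)
  -- the tie presentation's own datum, transported to the prime `(φ x, φ y)` (same ideal as `(x', y')`), gives a lex-maximal datum there;
  -- by …TiePresentationTransfer the filtrations of `(y', x')` and of any cotangent-independent admissible pair in the plane agree, so the
  -- pushed pair `(φ y, φ x)` is admissible upstairs; it is lex-maximal upstairs by §1 as soon as SOME lex-maximal datum with weights `(r, q)`,
  -- level `rν` is expressed at the prime `(φ x, φ y)`: we obtain it from the presentation via the identity of the two primes.
  have hPeq : Ideal.span ({x', y'} : Set T') = Ideal.span {algebraMap T T' x, algebraMap T T' y} := h'.2.1.symm.trans hP₀''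
  -- transport the presentation's datum along the identity of primes
  have hPQ : (Ideal.span ({x', y'} : Set T')).map ((RingEquiv.refl T' : T' ≃+* T') : T' →+* T') =
      Ideal.span {algebraMap T T' x, algebraMap T T' y} := by
    rw [map_span_pair]; exact hPeq
  have he : ∀ t : T', (locRingEquiv (RingEquiv.refl T') (Ideal.span ({x', y'} : Set T'))
        (Ideal.span ({algebraMap T T' x, algebraMap T T' y} : Set T')) hPQ) (algebraMap T' _ t) =
      algebraMap T' (Localization.AtPrime (Ideal.span ({algebraMap T T' x, algebraMap T T' y} : Set T'))) t := fun t => by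
    rw [locRingEquiv_apply]; rfl
  have hlexUp0 : IsLexMaxWeightedCentreGerm (Localization.AtPrime (Ideal.span ({algebraMap T T' x, algebraMap T T' y} : Set T')))
      (Ideal.span {algebraMap T' _ (algebraMap T T' g)}) ![algebraMap T' _ y', algebraMap T' _ x'] ![r, q] (r * ν) := by
    have h0 := LexMaxCentre.map_ringEquiv hlex'
      (locRingEquiv (RingEquiv.refl T') (Ideal.span ({x', y'} : Set T')) (Ideal.span ({algebraMap T T' x, algebraMap T T' y} : Set T')) hPQ)
    have hI : (Ideal.span {algebraMap T' (Localization.AtPrime (Ideal.span ({x', y'} : Set T'))) (algebraMap T T' g)}).map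
        ((locRingEquiv (RingEquiv.refl T') (Ideal.span ({x', y'} : Set T'))
          (Ideal.span ({algebraMap T T' x, algebraMap T T' y} : Set T')) hPQ : _ ≃+* _) : _ →+* _) =
        Ideal.span {algebraMap T' (Localization.AtPrime (Ideal.span ({algebraMap T T' x, algebraMap T T' y} : Set T'))) (algebraMap T T' g)} := by
      rw [Ideal.map_span, Set.image_singleton]
      exact congrArg (fun t => Ideal.span {t}) (he _)
    have hvec : (fun i => (locRingEquiv (RingEquiv.refl T') (Ideal.span ({x', y'} : Set T'))
          (Ideal.span ({algebraMap T T' x, algebraMap T T' y} : Set T')) hPQ)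
          ((![algebraMap T' (Localization.AtPrime (Ideal.span ({x', y'} : Set T'))) y',
             algebraMap T' (Localization.AtPrime (Ideal.span ({x', y'} : Set T'))) x'] : Fin 2 → _) i)) =
        ![algebraMap T' (Localization.AtPrime (Ideal.span ({algebraMap T T' x, algebraMap T T' y} : Set T'))) y',
          algebraMap T' (Localization.AtPrime (Ideal.span ({algebraMap T T' x, algebraMap T T' y} : Set T'))) x'] := by
      funext i; fin_cases i
      · exact he y'
      · exact he x'
    rw [hI, hvec] at h0
    exact h0
  -- admissibility of the pushed pair upstairs
  have hadmUp : Ideal.span {algebraMap T' (Localization.AtPrime (Ideal.span ({algebraMap T T' x, algebraMap T T' y} : Set T'))) (algebraMap T T' g)} ≤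
      weightedMonomialIdeal (fun i => algebraMap T' (Localization.AtPrime (Ideal.span ({algebraMap T T' x, algebraMap T T' y} : Set T')))
        ((![algebraMap T T' y, algebraMap T T' x] : Fin 2 → T') i)) ![r, q] (r * ν) := by
    -- contract the downstairs membership to `T`, extend to `T'`, localise
    have hyxz : Ideal.span (Set.range ![y, x, z]) = maximalIdeal T := by
      rw [← hxyz, Matrix.range_cons, Matrix.range_cons, Matrix.range_cons, Matrix.range_empty, Set.union_empty,
        Set.singleton_union, Set.singleton_union, Set.insert_comm]
    have huT : ∀ i, (![y, x] : Fin 2 → T) i ∈ maximalIdeal T := LocalGameEFTCylinder.mem_maximalIdeal_pair hyxz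
    have hliT := LocalGameEFTCylinder.linearIndependent_toCotangent_pair hyxz hsf
    have huPT : ∀ i, (![y, x] : Fin 2 → T) i ∈ Ideal.span ({x, y} : Set T) := by
      intro i; fin_cases i
      · exact Ideal.subset_span (Set.mem_insert_of_mem _ (Set.mem_singleton _))
      · exact Ideal.subset_span (Set.mem_insert _ _)
    have hr : 0 < r := hlex'.2.1 0
    have hν1 : 0 < ν := by
      by_contra h0
      have : ν = 0 := by omega
      subst this
      exact hgν1 (by rw [zero_add, pow_one]; exact hg𝔪)
    have hadmT : g ∈ weightedMonomialIdeal ![y, x] ![r, q] (r * ν) := by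
      rw [← comap_map_weightedMonomialIdeal_eq_of_linearIndependent (Ideal.span ({x, y} : Set T)) ![y, x] huT hliT huPT ![r, q]
        hlex'.2.1 (Nat.mul_pos hr hν1), Ideal.mem_comap]
      rwa [AQSBaseChange.map_weightedMonomialIdeal_two]
    have hadmT' : algebraMap T T' g ∈ weightedMonomialIdeal ![algebraMap T T' y, algebraMap T T' x] ![r, q] (r * ν) := by
      rw [← AQSBaseChange.map_weightedMonomialIdeal_two]; exact Ideal.mem_map_of_mem _ hadmT
    rw [Ideal.span_singleton_le_iff_mem, ← weightedMonomialIdeal_map]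
    exact Ideal.mem_map_of_mem _ hadmT'
  have hspanUp : Ideal.span (Set.range fun i => algebraMap T' (Localization.AtPrime (Ideal.span ({algebraMap T T' x, algebraMap T T' y} : Set T')))
      ((![algebraMap T T' y, algebraMap T T' x] : Fin 2 → T') i)) =
      maximalIdeal (Localization.AtPrime (Ideal.span ({algebraMap T T' x, algebraMap T T' y} : Set T'))) := by
    rw [Set.range_comp', ← Ideal.map_span, ← Localization.AtPrime.map_eq_maximalIdeal]
    congr 1
    rw [Matrix.range_cons, Matrix.range_cons, Matrix.range_empty, Set.union_empty, Set.singleton_union, Set.pair_comm]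
  have hlexUp := isLexMaxWeightedCentreGerm_of_admissible hlexUp0 hspanUp hadmUp
  -- descend to `T_{(x,y)}` along the localised homomorphism (faithfully flat, `𝔪 ↦ 𝔪`)
  set O := Localization.AtPrime (Ideal.span ({x, y} : Set T)) with hO
  set B := Localization.AtPrime (Ideal.span ({algebraMap T T' x, algebraMap T T' y} : Set T')) with hB
  have hcomap : (Ideal.span ({algebraMap T T' x, algebraMap T T' y} : Set T')).comap (algebraMap T T') = Ideal.span {x, y} :=
    comap_span_pair_map T T' x y
  letI : Algebra O B := (Localization.localRingHom _ _ (algebraMap T T') hcomap.symm).toAlgebra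
  haveI : IsScalarTower T O B := IsScalarTower.of_algebraMap_eq fun s => by
    change _ = Localization.localRingHom _ _ (algebraMap T T') hcomap.symm (algebraMap T O s)
    rw [Localization.localRingHom_to_map, IsScalarTower.algebraMap_apply T T' B]
  haveI : IsLocalHom (algebraMap O B) := Localization.isLocalHom_localRingHom _ _ (algebraMap T T') hcomap.symm
  haveI : IsRegularLocalRing O := isRegularLocalRing_localization_atPrime T _
  haveI : IsRegularLocalRing B := isRegularLocalRing_localization_atPrime T' _
  haveI : Algebra.FormallySmooth T B := Algebra.FormallySmooth.comp T T' B
  haveI : Algebra.EssFiniteType T B := Algebra.EssFiniteType.comp T T' B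
  haveI : Algebra.FormallySmooth O B := Algebra.FormallySmooth.localization_base (Ideal.span ({x, y} : Set T)).primeCompl
  haveI : Algebra.EssFiniteType O B := Algebra.EssFiniteType.of_comp T O B
  haveI : Module.Flat O B := IotaOrderEssSmooth.flat_of_formallySmooth_of_essFiniteType O B
  haveI : Module.FaithfullyFlat O B := Module.FaithfullyFlat.of_flat_of_isLocalHom
  have h𝔪O : (maximalIdeal O).map (algebraMap O B) = maximalIdeal B := by
    have h1 : maximalIdeal O = (Ideal.span ({x, y} : Set T)).map (algebraMap T O) := (Localization.AtPrime.map_eq_maximalIdeal).symm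
    have h2 : maximalIdeal B = (Ideal.span ({algebraMap T T' x, algebraMap T T' y} : Set T')).map (algebraMap T' B) :=
      (Localization.AtPrime.map_eq_maximalIdeal).symm
    rw [h1, h2, Ideal.map_map, ← IsScalarTower.algebraMap_eq T O B, IsScalarTower.algebraMap_eq T T' B, ← Ideal.map_map, map_span_pair]
  have hφ : ∀ s : T, algebraMap O B (algebraMap T O s) = algebraMap T' B (algebraMap T T' s) := fun s => by
    rw [← IsScalarTower.algebraMap_apply T O B, IsScalarTower.algebraMap_apply T T' B]
  have hlexUp' : IsLexMaxWeightedCentreGerm B (Ideal.span {algebraMap O B (algebraMap T O g)})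
      (fun i => algebraMap O B ((![algebraMap T O y, algebraMap T O x] : Fin 2 → O) i)) ![r, q] (r * ν) := by
    have hv : (fun i => algebraMap O B ((![algebraMap T O y, algebraMap T O x] : Fin 2 → O) i)) =
        fun i => algebraMap T' B ((![algebraMap T T' y, algebraMap T T' x] : Fin 2 → T') i) := by
      funext i; fin_cases i
      · exact hφ y
      · exact hφ x
    rw [hφ g, hv]; exact hlexUp
  have hspanO : Ideal.span (Set.range ![algebraMap T O y, algebraMap T O x]) = maximalIdeal O := by
    have h2 : Ideal.span ({algebraMap T O y, algebraMap T O x} : Set O) = Ideal.span {algebraMap T O x, algebraMap T O y} :=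
      Ideal.span_pair_comm
    rw [Matrix.range_cons, Matrix.range_cons, Matrix.range_empty, Set.union_empty, Set.singleton_union, h2, ← map_span_pair,
      Localization.AtPrime.map_eq_maximalIdeal]
  have hlexT := isLexMaxWeightedCentreGerm_of_map h𝔪O hspanO ((Ideal.span_singleton_le_iff_mem _).mpr hadm) hlexUp'
  exact isTiePosition_of_adapted_datum T T' hdimT ht' hxyz hP₀ hlexT

/-- **EQUAL-DIMENSION DESCENT WHEN THE TIE'S WEIGHTS ARE `(1, 1)`**: then EVERY regular system of parameters `(x, y, z)` of `T` with `(x, y) = P₀(T, g)`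
descends the tie (`𝒥ₙ((y,x);(1,1)) = P₀ⁿ T_{P₀}` and `g ∈ P₀^ν` by equimultiplicity along `V(P₀)`). [cite: AbramovichQuekSchober2025, Thm 3.5] -/
theorem isTiePosition_of_adapted_rsp_of_weights_one (hdimT : ringKrullDim T = (3 : ℕ)) {g : T} (ht' : IsTiePosition T' (algebraMap T T' g))
    {x' y' z' : T'} {lam' : T'} (h' : IsTiePresentation T' (algebraMap T T' g) x' y' z' 1 1 lam')
    {x y z : T} [hP : (Ideal.span ({x, y} : Set T)).IsPrime] (hxyz : Ideal.span {x, y, z} = maximalIdeal T)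
    (hP₀ : topStratumPrime iotaOrdEps T g = Ideal.span {x, y}) : IsTiePosition T g := by
  obtain ⟨-, -, ν, -, hfν, hfν1, -, -⟩ := id h'
  -- `g ∈ P₀^ν` by equimultiplicity along the top stratum
  obtain ⟨hgν, hgν1⟩ := mem_pow_and_not_mem_of_map T T' hfν hfν1
  have hg0 : g ≠ 0 := fun h0 => ht'.ne_zero (by rw [h0, map_zero])
  have hg𝔪 : g ∈ maximalIdeal T := by
    refine (IsLocalRing.mem_maximalIdeal g).mpr (mem_nonunits_iff.mpr fun hu => ?_)
    exact (IsLocalRing.mem_maximalIdeal _).mp ht'.mem_maximalIdeal (hu.map (algebraMap T T'))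
  have hν : iotaOrd T g = ν := (iotaOrd_eq_natCast_iff T g ν).mpr ⟨hgν, hgν1⟩
  have hdim3 : ringKrullDim T = 3 := by rw [hdimT]; rfl
  obtain ⟨hP₀p, hreg, -, hE, -, hmemν⟩ := topStratumPrime_iotaOrdEps_spec (le_of_eq hdim3) hg0 hg𝔪 hν
  rw [hP₀] at hmemν
  have hadm : algebraMap T (Localization.AtPrime (Ideal.span ({x, y} : Set T))) g ∈
      weightedMonomialIdeal ![algebraMap T (Localization.AtPrime (Ideal.span ({x, y} : Set T))) y,
        algebraMap T (Localization.AtPrime (Ideal.span ({x, y} : Set T))) x] ![1, 1] (1 * ν) := by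
    have h1 : algebraMap T (Localization.AtPrime (Ideal.span ({x, y} : Set T))) g ∈
        (Ideal.span {algebraMap T (Localization.AtPrime (Ideal.span ({x, y} : Set T))) x,
          algebraMap T (Localization.AtPrime (Ideal.span ({x, y} : Set T))) y}) ^ ν := by
      have h0 := Ideal.mem_map_of_mem (algebraMap T (Localization.AtPrime (Ideal.span ({x, y} : Set T)))) hmemν
      rwa [Ideal.map_pow, map_span_pair] at h0
    have h2 : (Ideal.span {algebraMap T (Localization.AtPrime (Ideal.span ({x, y} : Set T))) y,
        algebraMap T (Localization.AtPrime (Ideal.span ({x, y} : Set T))) x} : Ideal _) =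
        Ideal.span {algebraMap T (Localization.AtPrime (Ideal.span ({x, y} : Set T))) x,
          algebraMap T (Localization.AtPrime (Ideal.span ({x, y} : Set T))) y} := Ideal.span_pair_comm
    rw [LocalGameEFTSteepening.weightedMonomialIdeal_one_eq_pow, one_mul, h2]
    exact h1
  exact isTiePosition_of_adapted_admissible T T' hdimT ht' h' hfν hfν1 hxyz hP₀ hadm

end CaseB

end Iota3

end Summit.ResolutionOfSingularities.ResolutionOfSingularities.Cruxes.HypersurfaceCentreConstruction.LocalEngine

end
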